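import Mathlib.NumberTheory.Padics.PadicNumbers
import Mathlib.RingTheory.EssentialFiniteness
import Mathlib.Analysis.Complex.Polynomial.Basic
import Literature.AlgebraicGeometry.Motives.Varieties
import Literature.AlgebraicGeometry.Motives.HodgeStructure
import Literature.AlgebraicGeometry.Motives.PreWeilCohomology
import Literature.AlgebraicGeometry.Motives.WeilCohomology
import Literature.AlgebraicGeometry.Motives.GaloisRealization
import Literature.AlgebraicGeometry.Motives.BettiRealization
import HarnessLib

-- D-0014 sorry-sweep (operator, 2026-08-13): sorried theorems -> named facts `def X : Prop`; partial proofs preserved in comments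
-- provenance: harness21/H21/H21/Statements/Hodge/AbstractHodgeTate.lean @ d549e1a (interim HEAD d8f2665); M5 mechanical rewrite
/-!
# The Hodge, generalized Hodge and Tate conjectures (family Hodge, trunk MotiveAbstract)

This statements file assembles the *global* forms of three conjectures on algebraic cycles from
the per-variety `Prop`s of the prelude (`BettiHodgeData.HodgeConjectureFor`,
`BettiHodgeData.GeneralizedHodgeConjectureFor`, `GaloisWeilCohomology.TateConjectureFor`,
`GaloisWeilCohomology.TateSemisimplicityFor`). Following the outline (§1(f), §4.1) all three are
stated *against realization data*: the deep constructions (Betti cohomology with its Hodge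
decomposition and cycle class map; ℓ-adic étale cohomology with its Galois action) enter as the
hypothesis structures `Literature.BettiHodgeData k` and `Literature.GaloisWeilCohomology k K χ`, and the
conjectures are `Prop`-valued definitions only (open problems; no `theorem` is asserted).

* **hodge.S01** `Literature.Hodge.HodgeConjecture B` (Hodge 1950; Deligne, Clay problem description
  2000/2006): for every smooth projective `X/ℂ` and every `p`, the `ℚ`-span of the classes of
  codimension-`p` algebraic cycles is the space of Hodge classes
  `Hdgᵖ(X) = H²ᵖ(X, ℚ) ∩ Hᵖ,ᵖ(X)`. The Clay statement is this `Prop` at `B :=` the Betti–Hodge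
  realization (singular cohomology of `X(ℂ)` with its Hodge decomposition and cycle class map —
  inventory notions `analytification`, `hodge_decomposition`, `cycle_class_map`, size L, not yet
  constructed). Also `HodgeConjectureOver k B` for varieties and cycles over an algebraically
  closed subfield `k ⊆ ℂ`.
* **hodge.S24** `Literature.Hodge.GeneralizedHodgeConjecture B` (Grothendieck, *Hodge's general
  conjecture is false for trivial reasons*, Topology 8 (1969)): every sub-`ℚ`-Hodge structure of
  `Hⁱ(X, ℚ)` of level `≤ i - 2r` is supported in codimension `r` (lies in the coniveau
  filtration `Nʳ Hⁱ`).
* **hodge.S06** `Literature.Hodge.TateConjecture ℓ E` (Tate, Woods Hole 1964; Tate, PSPM 55 (1994),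
  §1, Conjectures `Tᵖ(X/k)` and semisimplicity): for `k` finitely generated and `ℓ` invertible in
  `k`, for every smooth projective `X/k` and every `p`, the `ℚ_ℓ`-span of algebraic classes is
  the space of Galois invariants of `H²ᵖ(X_{k̄}, ℚ_ℓ(p))`, and `Γ_k` acts semisimply on
  `H²ᵖ(X_{k̄}, ℚ_ℓ)`. Instantiate `E :=` ℓ-adic étale cohomology with its Galois action (size L;
  Mathlib anchor `Scheme.EllAdicCohomology`, which carries no Galois action yet); the Tate twist
  is Mathlib's cyclotomic character through `Literature.padicCyclotomicCharacter k ℓ`.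

Sanity statements: `hodgeConjecture_iff` / `tateConjecture_iff` (only the inclusions
`Hdg ⊆ ℚ·A`, `H^Γ ⊆ ℚ_ℓ·A` have content), `tateConjectureFor_iff_invariants_le`,
`hodgeConjectureFor_zero` (`p = 0`; proved, `hodgeConjectureFor_zero_holds`, via
`WeilCohomology.algebraicClasses_zero_eq_top`), `generalizedHodgeConjectureFor_zero` (`r = 0`).

## Mathlib searches / design choices

* Mathlib has none of: Hodge conjecture, Tate conjecture, Hodge classes, Tate classes, coniveau
  (searched `HodgeConjecture`, `TateConjecture`, `hodgeClasses`, `coniveau`, `Betti`: no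
  declarations). Used from Mathlib: `Algebra.EssFiniteType ℤ k` ("`k` is a finitely generated
  field": essentially of finite type over `ℤ`, i.e. a localization of a finitely generated
  `ℤ`-algebra — for a field this is equivalent to being finitely generated as a field),
  `NeZero (ℓ : k)` for "`ℓ ≠ char k`" (the outline's explicit hypothesis `(hℓ : (ℓ : k) ≠ 0)`
  is phrased as this instance argument, Mathlib's idiom, e.g. for roots of unity), `ℚ_[ℓ]`,
  `Fact ℓ.Prime`, `IsAlgClosed`, `Representation.invariants`,
  `Representation.IsSemisimpleRepresentation`.
* `HodgeConjectureOver` carries `[IsAlgClosed k]`: for `k = k̄ ⊆ ℂ` the statement "Hodge classes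
  on `X(ℂ)` are spanned by classes of `k`-cycles" is equivalent (by spreading out and
  specialising cycles) to the Hodge conjecture for `X_ℂ`; without algebraic closedness it is
  false for trivial Galois-descent reasons (a quadric surface over `ℚ` with non-split rulings),
  which would be a vacuity smell. `HodgeConjecture B` is definitionally `HodgeConjectureOver ℂ B`.
* `TateConjecture` is universe-polymorphic in `k`; the Hodge-side statements live in `Type`
  because `BettiHodgeData` does (complex points, singular cohomology in universe `0`).
* hodge.S26 (the *definition* of ℓ-adic cohomology with its Galois action) is **not** claimed.

## References

* W. V. D. Hodge, *The topological invariants of algebraic varieties*, Proc. ICM 1950.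
* P. Deligne, *The Hodge conjecture*, Clay Millennium Problem description (2000; in *The
  Millennium Prize Problems*, 2006).
* A. Grothendieck, *Hodge's general conjecture is false for trivial reasons*, Topology 8 (1969),
  299–303, §§1–2.
* C. Voisin, *Hodge Theory and Complex Algebraic Geometry I*, CUP 2002, §11.1.2 (cycle class
  `[Z] = j_Z (T⁻¹ 1)`, pp. 269–273), §11.3.1 Def. 11.28 (Hodge classes), §11.3.2 Conj. 11.36 (the
  Hodge conjecture, p. 284);
  C. Voisin, *The Hodge conjecture* (survey, 2016), Conj. 3.
* J. Tate, *Algebraic cycles and poles of zeta functions*, Woods Hole 1964 / in *Arithmetical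
  Algebraic Geometry* (1965).
* J. Tate, *Conjectures on algebraic cycles in ℓ-adic cohomology*, in Motives, PSPM 55 (1994),
  §§1–2.
-/

universe u

open CategoryTheory AlgebraicGeometry Opposite

noncomputable section

namespace Literature.AlgebraicGeometry.Motives

section Hodge

/-! ### The Hodge conjecture -/

section Hodge

variable {k : Type} [Field k] [Algebra k ℂ]

variable (k) in
/-- The **Hodge conjecture over an algebraically closed subfield `k ⊆ ℂ`**, relative to
Betti–Hodge realization data `B`: for every smooth projective `X/k` and every `p : ℕ`, the
`ℚ`-span of the classes of codimension-`p` cycles on `X` equals the space of Hodge classes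
`H²ᵖ(X(ℂ), ℚ) ∩ Hᵖ,ᵖ` (Hodge 1950; Deligne, Clay problem description, §1; for `k = ℚ̄` this is
the Hodge conjecture for varieties definable over `ℚ̄`, cf. Voisin 2016, §2). Algebraic
closedness of `k` is assumed: cycles on `X_ℂ` then specialise to cycles over `k` with the same
class, so this is the Hodge conjecture for `X_ℂ`; over a non-closed `k` the analogous statement
fails by Galois descent and is not the conjecture. A `Prop`-valued definition (open problem).
[cite: HodgeICM1950, p. 184] [cite: DeligneHodgeClay2006, §1] -/
@[nolint unusedArguments] -- `[IsAlgClosed k]` is a deliberate hypothesis of the conjecture.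
def HodgeConjectureOver [IsAlgClosed k] (B : BettiHodgeData k) : Prop :=
  ∀ ⦃n : ℕ⦄ ⦃X : SchemeOver k⦄ (hX : IsSmoothProjective n X) (p : ℕ), B.HodgeConjectureFor hX p

/-- The Hodge conjecture (relative to `B`) is equivalent to the family of inclusions
`Hdgᵖ(X) ⊆ ℚ · Aᵖ(X)`: the reverse inclusions hold unconditionally
(`BettiHodgeData.algebraicClasses_le_hodgeClasses`; Voisin I, Prop. 11.20).
[cite: VoisinHodgeI2002, Prop. 11.20] -/
theorem hodgeConjectureOver_iff [IsAlgClosed k] (B : BettiHodgeData k) :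
    HodgeConjectureOver k B ↔ ∀ ⦃n : ℕ⦄ ⦃X : SchemeOver k⦄ (hX : IsSmoothProjective n X)
      (p : ℕ), (B.hodge hX (2 * p)).hodgeClasses p ≤ B.W.algebraicClasses X p :=
  forall₄_congr fun _ _ hX p ↦ B.hodgeConjectureFor_iff hX p

/-- Sanity (`p = 0`): the Hodge conjecture holds in codimension `0` for every smooth projective
`X` (Voisin I, §11.3: `Hdg⁰(X) = H⁰(X, ℚ) = ℚ · [X]`). Proof sketch: `H⁰(X)` is
one-dimensional (`WeilCohomology.finrank_obj_zero`) and contains the class of the generic point,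
which is the unit `1 ≠ 0` (`WeilCohomology.cycleClass_of_coheight_eq_zero`), so
`ℚ · A⁰(X) = H⁰(X) ⊇ Hdg⁰(X)`. [cite: VoisinHodgeI2002, §11.3] -/
def hodgeConjectureFor_zero : Prop :=
  ∀ (B : BettiHodgeData k) {n : ℕ} {X : SchemeOver k} (hX : IsSmoothProjective n X),
    B.HodgeConjectureFor hX 0

/-- A generic point of (the whole underlying space of) a scheme has codimension `0`: it
specialises to every point, so it is maximal for the specialisation order of `Scheme`
(`a ≤ b ↔ b ⤳ a`), i.e. `Order.coheight η = 0` (Hartshorne II, Ex. 2.9 and Ex. 3.20). [folklore] -/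
theorem coheight_eq_zero_of_isGenericPoint_univ {X : Scheme.{u}} {η : X}
    (hη : IsGenericPoint η (Set.univ : Set X)) : Order.coheight η = 0 := by
  rw [Order.coheight_eq_zero]
  intro b _
  exact Scheme.le_iff_specializes.2 (hη.specializes (Set.mem_univ b))

omit [Algebra k ℂ] in
/-- A smooth projective variety `X/k` is an irreducible topological space (geometrically
irreducible over the point `Spec k`; Mathlib
`GeometricallyIrreducible.irreducibleSpace_of_subsingleton`, Stacks 0366). [folklore] -/
theorem IsSmoothProjective.irreducibleSpace {n : ℕ} {X : SchemeOver k}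
    (hX : IsSmoothProjective n X) : IrreducibleSpace X.left :=
  haveI := hX.geometricallyIrreducible
  GeometricallyIrreducible.irreducibleSpace_of_subsingleton X.hom

omit [Algebra k ℂ] in
/-- The unit `1 ∈ H⁰(X)` of a Weil cohomology theory is an algebraic class on a smooth projective
`X`: it is the class `γ_X [X]` of the codimension-`0` prime cycle `X = closure {η}`, `η` the
generic point (Kleiman 1968, §1.2 (C), `γ_X (1_X) = 1`; the axiom
`WeilCohomology.cycleClass_of_coheight_eq_zero`). In Voisin's construction of the Betti cycle
class, `[Z] = j_Z (T⁻¹ 1)` with `j_X = T = id` for `Z = X` (Voisin I, §11.1.2).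
[cite: Kleiman1968, §1.2 (C)] [cite: VoisinHodgeI2002, §11.1.2] -/
theorem WeilCohomology.one_mem_algebraicClasses {K : Type*} [Field K] [CharZero K]
    (W : WeilCohomology k K) {n : ℕ} {X : SchemeOver k} (hX : IsSmoothProjective n X) :
    W.one X ∈ W.algebraicClasses X 0 := by
  haveI := hX.irreducibleSpace
  have hη : Order.coheight (genericPoint X.left) = 0 :=
    coheight_eq_zero_of_isGenericPoint_univ (genericPoint_spec X.left)
  rw [← W.cycleClass_of_coheight_eq_zero hX _ hη]
  exact W.algebraicLattice_le_algebraicClasses X 0 (W.cycleClass_mem_algebraicLattice X 0 hη)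

omit [Algebra k ℂ] in
/-- For a Weil cohomology theory `W` and a smooth projective `X`, algebraic classes span `H⁰(X)`:
`K · A⁰(X) = H⁰(X)`. Indeed `1 = γ_X [X] ∈ A⁰(X)` (`WeilCohomology.one_mem_algebraicClasses`);
if `1 ≠ 0` it spans the one-dimensional space `H⁰(X)` (`WeilCohomology.finrank_obj_zero`,
Kleiman 1968, §1.2 (A)), and if `1 = 0` then `H⁰(X) = 0` since `a = 1 ∪ a`
(`WeilCohomology.one_cup`). [cite: Kleiman1968, §1.2 (A), (C)] -/
theorem WeilCohomology.algebraicClasses_zero_eq_top {K : Type*} [Field K] [CharZero K]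
    (W : WeilCohomology k K) {n : ℕ} {X : SchemeOver k} (hX : IsSmoothProjective n X) :
    W.algebraicClasses X 0 = ⊤ := by
  have h1 := W.one_mem_algebraicClasses hX
  by_cases h0 : W.one X = 0
  · refine eq_top_iff.2 fun a _ ↦ ?_
    have : a = 0 := by
      rw [← W.one_cup hX (Nat.zero_add 0) a, h0, map_zero, LinearMap.zero_apply]
    rw [this]
    exact zero_mem _
  · have hspan : Submodule.span K {W.one X} = ⊤ :=
      (finrank_eq_one_iff_of_nonzero _ h0).1 (W.finrank_obj_zero hX)
    refine eq_top_iff.2 ?_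
    change (⊤ : Submodule K (W.obj X 0)) ≤ _
    rw [← hspan, Submodule.span_le, Set.singleton_subset_iff]
    exact h1

/-- **Discharge of `hodgeConjectureFor_zero`**: the Hodge conjecture holds in codimension `0` for
every smooth projective `X/k` and every Betti–Hodge realization datum `B`. This is the case
`k = 0` of Voisin I, Conj. 11.36 (§11.3.2, p. 284; Hodge classes as in Def. 11.28), which is
trivial and not spelled out in print: by §11.1.2 the class of the codimension-`0` cycle `X` is
`[X] = j_X (T⁻¹ 1) = 1 ∈ H⁰(X, ℤ)`, and `H⁰(X, ℚ) = ℚ · 1` for connected `X`, so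
`Hdg⁰(X) ⊆ H⁰(X, ℚ) = ℚ · [X] ⊆ ℚ · A⁰(X)`. In the axiomatic setting of `BettiHodgeData` the same
argument reads: `ℚ · A⁰(X) = H⁰(X)` (`WeilCohomology.algebraicClasses_zero_eq_top`: `1 = γ_X [X]`
is algebraic and spans the one-dimensional `H⁰(X)`), hence contains `Hdg⁰(X)`; the reverse
inclusion is `BettiHodgeData.algebraicClasses_le_hodgeClasses` (Voisin I, Prop. 11.20).
[cite: VoisinHodgeI2002, §11.3.2 Conj. 11.36 (case k = 0), §11.1.2] -/
theorem hodgeConjectureFor_zero_holds : hodgeConjectureFor_zero (k := k) := by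
  intro B n X hX
  rw [B.hodgeConjectureFor_iff, B.W.algebraicClasses_zero_eq_top hX]
  exact le_top

/-! ### The generalized Hodge conjecture -/

/-- **hodge.S24** (Grothendieck's generalized Hodge conjecture, coniveau form; Grothendieck,
*Hodge's general conjecture is false for trivial reasons*, Topology 8 (1969), §§1–2; Voisin,
*The Hodge conjecture* (2016), Conj. 3). Relative to Betti–Hodge realization data `B` over `ℂ`:
for every smooth projective complex `X`, every degree `i` and every `r`, every rational
sub-Hodge structure `S ⊆ Hⁱ(X, ℚ)` of level `≤ i - 2r` (i.e. `S_ℂ ⊆ Fʳ + conj Fʳ`, "coniveau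
`≥ r`" in Hodge-theoretic terms) is supported on a closed algebraic subset of codimension
`≥ r`, i.e. lies in the coniveau filtration `Nʳ Hⁱ_B(X)` (`Literature.AlgebraicGeometry.Motives.coniveau`;
`BettiHodgeData.GeneralizedHodgeConjectureFor`). A `Prop`-valued definition (open problem).

Relation to the printed statement (Topology 8, p. 300, §2, "This makes clear how the Hodge
conjecture should be corrected …"): with `Filt'ᵖ` Grothendieck's "arithmetic" (coniveau)
filtration and `Filtᵖ` the Hodge filtration, the corrected conjecture reads
`Filt'ᵖ Hⁱ(X, ℚ) =` *the largest subspace of* `Filtᵖ Hⁱ(X, ℂ) ∩ Hⁱ(X, ℚ)` *generating a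
sub-Hodge structure of* `Hⁱ(X, ℂ)`. The inclusion `⊆` is recorded there as known (formula `(*)`,
p. 299, together with the remark, p. 300, that `Filt'ᵖ` is a sub-Hodge structure); the
conjectural content is `⊇`, which is this `Prop`: a rational sub-Hodge structure `S` of the
weight-`i` structure `Hⁱ(X, ℚ)` has `S_ℂ ⊆ Fᵖ` iff (by Hodge symmetry) its non-zero pieces
`S^{a,b}`, `a + b = i`, have `a, b ≥ p`, iff `level S ≤ i - 2p`; and "every such `S` lies in
`Nᵖ`" is "the largest such `S` lies in `Nᵖ`" (`generalizedHodgeConjecture_iff_iSup_le`).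
Grothendieck assumes `i ≤ dim X` "for simplicity" (p. 300, l. 1); the coniveau form is stated
here in every degree, as in Voisin (2016), Conj. 3. This is an open conjecture (its case
`(i, r) = (2p, p)` is the Hodge conjecture, p. 301), so no `_holds` theorem is provided.
[cite: GrothendieckTopology1969, §2, p. 300–301] -/
def GeneralizedHodgeConjecture (B : BettiHodgeData ℂ) : Prop :=
  ∀ ⦃n : ℕ⦄ ⦃X : SchemeOver ℂ⦄ (hX : IsSmoothProjective n X) (i r : ℕ),
    B.GeneralizedHodgeConjectureFor hX i r

/-- Grothendieck's own phrasing of the (conjectural half of the) corrected general Hodge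
conjecture (Topology 8 (1969), p. 300, §2): for every smooth projective `X/ℂ`, `i` and `r`, the
*largest* rational sub-Hodge structure of `Hⁱ(X, ℚ)` contained in `Fʳ Hⁱ(X, ℂ)` (the supremum
of the sub-Hodge structures of level `≤ i - 2r`) lies in the coniveau-`r` piece `Nʳ Hⁱ_B(X)`.
Equivalent to `GeneralizedHodgeConjecture B` by `iSup_le_iff`.
[cite: GrothendieckTopology1969, §2, p. 300] -/
theorem generalizedHodgeConjecture_iff_iSup_le (B : BettiHodgeData ℂ) :
    GeneralizedHodgeConjecture B ↔
      ∀ ⦃n : ℕ⦄ ⦃X : SchemeOver ℂ⦄ (hX : IsSmoothProjective n X) (i r : ℕ),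
        ⨆ (S : HodgeStructure.SubHodgeStructure (B.hodge hX i)) (_ : S.level + 2 * r ≤ i),
          S.toSubmodule.map ((B.iso i).hom.app (op X)).hom ≤ coniveau X i r := by
  refine forall₅_congr fun n X hX i r ↦ ?_
  simp only [BettiHodgeData.GeneralizedHodgeConjectureFor, iSup_le_iff]

/-- Sanity (`r = 0`): every sub-Hodge structure of `Hⁱ(X, ℚ)` is supported in codimension `0`,
since `N⁰ Hⁱ_B(X) = Hⁱ_B(X)` (`Literature.AlgebraicGeometry.Motives.coniveau_zero`; Grothendieck 1969, §1).
[cite: GrothendieckTopology1969, §1] -/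
theorem generalizedHodgeConjectureFor_zero (B : BettiHodgeData k) {n : ℕ} {X : SchemeOver k}
    (hX : IsSmoothProjective n X) (i : ℕ) : B.GeneralizedHodgeConjectureFor hX i 0 := by
  intro S _
  rw [coniveau_zero]
  exact le_top

/-- The generalized Hodge conjecture in degree `2p` and coniveau `p` concerns the sub-Hodge
structures of level `0` of `H²ᵖ(X, ℚ)`, i.e. those contained in the Hodge classes; unfolding
of the definition at `(i, r) = (2p, p)` (Grothendieck 1969, §2, where it is remarked that this
case is the classical Hodge conjecture). [cite: GrothendieckTopology1969, §2] -/
theorem generalizedHodgeConjecture_two_mul (B : BettiHodgeData ℂ) (h : GeneralizedHodgeConjecture B)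
    {n : ℕ} {X : SchemeOver ℂ} (hX : IsSmoothProjective n X) (p : ℕ)
    (S : HodgeStructure.SubHodgeStructure (B.hodge hX (2 * p))) (hS : S.level = 0) :
    S.toSubmodule.map ((B.iso (2 * p)).hom.app (op X)).hom ≤ coniveau X (2 * p) p :=
  h hX (2 * p) p S (by omega)

end Hodge

/-! ### The Tate conjecture -/

section Tate

variable {k : Type u} [Field k]

/-- **hodge.S06** (the Tate conjecture; Tate, *Algebraic cycles and poles of zeta functions*,
Woods Hole 1964; Tate, *Conjectures on algebraic cycles in ℓ-adic cohomology*, PSPM 55 (1994),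
§1, Conjecture `Tᵖ(X/k)` and the semisimplicity conjecture). For a finitely generated field `k`
(Mathlib: `Algebra.EssFiniteType ℤ k`), a prime `ℓ ≠ char k` (Mathlib: `NeZero (ℓ : k)`) and
a Weil cohomology theory `E` over `k` with `ℚ_ℓ`-coefficients and Galois action, Tate-twisted by
the ℓ-adic cyclotomic character `padicCyclotomicCharacter k ℓ`: for every smooth projective
`X/k` and every `p`, the `ℚ_ℓ`-span of the classes of codimension-`p` cycles on `X` equals the
Galois invariants `(H²ᵖ(X)(p))^{Γ_k}` (`GaloisWeilCohomology.TateConjectureFor`; the inclusion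
`⊆` is `GaloisWeilCohomology.algebraicClasses_le_invariants`), and `Γ_k` acts semisimply on
`H²ᵖ(X)` (`GaloisWeilCohomology.TateSemisimplicityFor`, Mathlib's
`Representation.IsSemisimpleRepresentation`). **Tate's conjecture is this `Prop` at `E :=`
ℓ-adic étale cohomology `X ↦ H•_ét(X_{k̄}, ℚ_ℓ)` with its Galois action** (not yet available;
Mathlib anchor `Scheme.EllAdicCohomology`). A `Prop`-valued definition (open problem).
[cite: TateWoodsHole1965, Conjecture 1] [cite: TateMotives1994, §1 Conjecture Tᵖ] -/
@[nolint unusedArguments] -- finite generation of `k` and `ℓ ≠ char k` are deliberate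
-- hypotheses of the conjecture (it is false without them), not used in the body.
def TateConjecture [Algebra.EssFiniteType ℤ k] (ℓ : ℕ) [Fact ℓ.Prime] [NeZero (ℓ : k)]
    (E : GaloisWeilCohomology k ℚ_[ℓ] (padicCyclotomicCharacter k ℓ)) : Prop :=
  ∀ ⦃n : ℕ⦄ ⦃X : SchemeOver k⦄, IsSmoothProjective n X →
    ∀ p : ℕ, E.TateConjectureFor X p ∧ E.TateSemisimplicityFor X (2 * p)

/-- Tate's `Tᵖ(X/k)` for a smooth projective `X` is equivalent to the inclusion
`(H²ᵖ(X)(p))^{Γ_k} ⊆ ℚ_ℓ · Aᵖ(X)`: algebraic classes are always Galois invariant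
(`GaloisWeilCohomology.algebraicClasses_le_invariants`; Tate 1994, §1). Stated for any
coefficient field and twisting character. [cite: TateMotives1994, §1] -/
theorem tateConjectureFor_iff_invariants_le {K : Type*} [Field K] [CharZero K]
    {χ : Field.absoluteGaloisGroup k →* Kˣ} (E : GaloisWeilCohomology k K χ) {n : ℕ}
    {X : SchemeOver k} (hX : IsSmoothProjective n X) (p : ℕ) :
    E.TateConjectureFor X p ↔ (E.ρTwist X (2 * p) p).invariants ≤ E.algebraicClasses X p :=
  ⟨fun h ↦ h.ge, fun h ↦ le_antisymm (E.algebraicClasses_le_invariants hX p) h⟩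

/-- The Tate conjecture (relative to `E`) unfolds to: for every smooth projective `X` and every
`p`, `(H²ᵖ(X)(p))^{Γ_k} ⊆ ℚ_ℓ · Aᵖ(X)` and `H²ᵖ(X)` is a semisimple `Γ_k`-representation
(Tate 1994, §1). [cite: TateMotives1994, §1] -/
theorem tateConjecture_iff [Algebra.EssFiniteType ℤ k] (ℓ : ℕ) [Fact ℓ.Prime] [NeZero (ℓ : k)]
    (E : GaloisWeilCohomology k ℚ_[ℓ] (padicCyclotomicCharacter k ℓ)) :
    TateConjecture ℓ E ↔ ∀ ⦃n : ℕ⦄ ⦃X : SchemeOver k⦄, IsSmoothProjective n X → ∀ p : ℕ,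
      (E.ρTwist X (2 * p) p).invariants ≤ E.algebraicClasses X p ∧
        (E.ρ X (2 * p)).IsSemisimpleRepresentation := by
  refine forall₃_congr fun n X hX ↦ forall_congr' fun p ↦ ?_
  rw [tateConjectureFor_iff_invariants_le E hX p]
  rfl

/-- Algebraic classes of a smooth projective `X` are Tate classes:
`K · Aᵖ(X) ⊆ (H²ᵖ(X)(p))^{Γ_k} ⊆ Tateᵖ(X)` (Tate 1994, §1; composite of
`GaloisWeilCohomology.algebraicClasses_le_invariants` and
`GaloisWeilCohomology.invariants_le_tateClasses`). [cite: TateMotives1994, §1] -/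
theorem algebraicClasses_le_tateClasses {K : Type*} [Field K] [CharZero K]
    {χ : Field.absoluteGaloisGroup k →* Kˣ} (E : GaloisWeilCohomology k K χ) {n : ℕ}
    {X : SchemeOver k} (hX : IsSmoothProjective n X) (p : ℕ) :
    E.algebraicClasses X p ≤ E.tateClasses X p :=
  (E.algebraicClasses_le_invariants hX p).trans (E.invariants_le_tateClasses X p)

end Tate

end Hodge

end Literature.AlgebraicGeometry.Motives

end
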